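import Literature.Probability.LatticeModels.SahiThirdOrderCorrelation
import Literature.Probability.LatticeModels.ProdBernoulliIndependence
import Mathlib.Tactic.Linarith
import Mathlib.Tactic.Ring
import HarnessLib

/-!
# Kahn's Conjecture 5 is closed under a common independent AND-factor

Support file (seat `prim-masterthm-p1`, gen 14; `--supports stmt-CriticalPhenomena-4575`).  Pure proofs, no definition, no `sorry`,
standard axioms.  Memo `run/shared/lean/prim/prim-masterthm/FROM-prim-masterthm-p1-g14-PRINCIPAL-SANDWICH.md` §1.

**THEOREM (`sahiE3_inter_commonFactor_ge`).**  Let `A, B, C ⊆ 2^ι` be increasing events determined by a finite coordinate set `F`, and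
`D` ANY event determined by the complementary coordinates (so `D` is independent of `σ(A,B,C)` under a product measure `μ_p`).  Then

  `E₃(A ∩ D, B ∩ D, C ∩ D) ≥ μ(D) · E₃(A, B, C)`,

where `E₃(X,Y,Z) = 2μ(XYZ) + μ(X)μ(Y)μ(Z) − Σ μ(X)μ(YZ)` is Sahi's third-order functional (tree `sahiE3`).  Indeed with `d = μ(D)`,
`s = Σ μ(A)μ(B∩C)`, `t = μ(A)μ(B)μ(C)`:  `E₃(AD,BD,CD) − d·E₃(A,B,C) = d(1−d)·[(s − 3t) + t(2 − d)]` and `s ≥ 3t` by Harris.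
COROLLARY (`sahiE3_inter_commonFactor_nonneg`): `E₃(A,B,C) ≥ 0 ⟹ E₃(A∩D, B∩D, C∩D) ≥ 0` — Kahn's Conjecture 5 [Kahn2022, Conj. 5] reduces to
triples with no coordinate forced open by all three events (a common AND-factor `x_u` splits off), and every proved stratum extends by
independent AND-factors (e.g. `(x₄(x₂∨x₃), x₄(x₁∨x₃), x₄(x₁∨x₂))` = `x₄ ∧` the atom-covering triangle; the quadratic `q(d)` of the proof has its
smaller root at `d ≈ 1.028` there, so the margin is genuinely thin).  HONEST FRAMING: an elementary closure property; C5 itself remains OPEN. [this work]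
-/

noncomputable section

open scoped Classical

namespace Summit.CriticalPhenomena.PercolationContinuityZ3.Theorems

namespace SahiCommonFactor

open MeasureTheory Set
open Literature.Probability.LatticeModels (prodBernoulli sahiE3 sahiE3_def prodBernoulli_real_inter_of_determinedBy
  prodBernoulli_harris)
open Literature.Probability.Percolation (DeterminedBy)

variable {ι : Type} [Fintype ι]

omit [Fintype ι] in
/-- Intersections with a common set regroup: `(A ∩ D) ∩ (B ∩ D) = (A ∩ B) ∩ D`. [folklore] -/
theorem inter_inter_inter_comm_right (A B D : Set (Set ι)) : (A ∩ D) ∩ (B ∩ D) = (A ∩ B) ∩ D := by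
  ext ω; simp only [mem_inter_iff]; tauto

omit [Fintype ι] in
/-- Triple version: `(A ∩ D) ∩ (B ∩ D) ∩ (C ∩ D) = (A ∩ B ∩ C) ∩ D`. [folklore] -/
theorem inter_inter_inter_comm_right₃ (A B C D : Set (Set ι)) :
    (A ∩ D) ∩ (B ∩ D) ∩ (C ∩ D) = (A ∩ B ∩ C) ∩ D := by
  ext ω; simp only [mem_inter_iff]; tauto

/-- **Common independent AND-factor.**  For increasing `A, B, C` determined by `F` and any `D` determined by `Fᶜ`:
`μ(D)·E₃(A,B,C) ≤ E₃(A∩D, B∩D, C∩D)` under every product measure. [this work] -/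
theorem sahiE3_inter_commonFactor_ge (p : ι → unitInterval) (F : Finset ι) {A B C D : Set (Set ι)}
    (hA : IsUpperSet A) (hB : IsUpperSet B) (hC : IsUpperSet C)
    (dA : DeterminedBy A (↑F : Set ι)) (dB : DeterminedBy B (↑F : Set ι)) (dC : DeterminedBy C (↑F : Set ι))
    (dD : DeterminedBy D (↑F : Set ι)ᶜ) :
    (prodBernoulli p).real D * sahiE3 (prodBernoulli p) A B C ≤
      sahiE3 (prodBernoulli p) (A ∩ D) (B ∩ D) (C ∩ D) := by
  set μ := prodBernoulli p with hμ
  have ms : ∀ X : Set (Set ι), MeasurableSet X := fun _ => MeasurableSet.of_discrete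
  -- independence of `D` from every event determined by `F`
  have ind : ∀ {X : Set (Set ι)}, DeterminedBy X (↑F : Set ι) → μ.real (X ∩ D) = μ.real X * μ.real D :=
    fun hX => prodBernoulli_real_inter_of_determinedBy p F hX dD (ms _) (ms _)
  have dAB : DeterminedBy (A ∩ B) (↑F : Set ι) := dA.inter dB
  have dAC : DeterminedBy (A ∩ C) (↑F : Set ι) := dA.inter dC
  have dBC : DeterminedBy (B ∩ C) (↑F : Set ι) := dB.inter dC
  have dABC : DeterminedBy (A ∩ B ∩ C) (↑F : Set ι) := dAB.inter dC
  have e1 : μ.real ((A ∩ D) ∩ (B ∩ D) ∩ (C ∩ D)) = μ.real (A ∩ B ∩ C) * μ.real D := by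
    rw [inter_inter_inter_comm_right₃, ind dABC]
  have eAB : μ.real ((A ∩ D) ∩ (B ∩ D)) = μ.real (A ∩ B) * μ.real D := by
    rw [inter_inter_inter_comm_right, ind dAB]
  have eAC : μ.real ((A ∩ D) ∩ (C ∩ D)) = μ.real (A ∩ C) * μ.real D := by
    rw [inter_inter_inter_comm_right, ind dAC]
  have eBC : μ.real ((B ∩ D) ∩ (C ∩ D)) = μ.real (B ∩ C) * μ.real D := by
    rw [inter_inter_inter_comm_right, ind dBC]
  have eA : μ.real (A ∩ D) = μ.real A * μ.real D := ind dA
  have eB : μ.real (B ∩ D) = μ.real B * μ.real D := ind dB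
  have eC : μ.real (C ∩ D) = μ.real C * μ.real D := ind dC
  -- Harris for the three pairs, and elementary bounds
  have hBC : μ.real B * μ.real C ≤ μ.real (B ∩ C) := prodBernoulli_harris p hB hC (ms _) (ms _)
  have hAC : μ.real A * μ.real C ≤ μ.real (A ∩ C) := prodBernoulli_harris p hA hC (ms _) (ms _)
  have hAB : μ.real A * μ.real B ≤ μ.real (A ∩ B) := prodBernoulli_harris p hA hB (ms _) (ms _)
  have a0 : 0 ≤ μ.real A := measureReal_nonneg
  have b0 : 0 ≤ μ.real B := measureReal_nonneg
  have c0 : 0 ≤ μ.real C := measureReal_nonneg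
  have d0 : 0 ≤ μ.real D := measureReal_nonneg
  have d1 : μ.real D ≤ 1 := (measureReal_mono (subset_univ D)).trans_eq probReal_univ
  rw [sahiE3_def, sahiE3_def, e1, eAB, eAC, eBC, eA, eB, eC]
  set a := μ.real A; set b := μ.real B; set c := μ.real C; set d := μ.real D
  set mAB := μ.real (A ∩ B); set mAC := μ.real (A ∩ C); set mBC := μ.real (B ∩ C); set m3 := μ.real (A ∩ B ∩ C)
  have key : 2 * (m3 * d) + a * d * (b * d) * (c * d) -
        (a * d * (mBC * d) + b * d * (mAC * d) + c * d * (mAB * d)) -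
      d * (2 * m3 + a * b * c - (a * mBC + b * mAC + c * mAB)) =
      d * (1 - d) * (a * (mBC - b * c) + b * (mAC - a * c) + c * (mAB - a * b) + a * b * c * (2 - d)) := by
    ring
  have t1 : 0 ≤ a * (mBC - b * c) := mul_nonneg a0 (sub_nonneg.2 hBC)
  have t2 : 0 ≤ b * (mAC - a * c) := mul_nonneg b0 (sub_nonneg.2 hAC)
  have t3 : 0 ≤ c * (mAB - a * b) := mul_nonneg c0 (sub_nonneg.2 hAB)
  have t4 : 0 ≤ a * b * c * (2 - d) := mul_nonneg (mul_nonneg (mul_nonneg a0 b0) c0) (by linarith)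
  have hsum : 0 ≤ d * (1 - d) * (a * (mBC - b * c) + b * (mAC - a * c) + c * (mAB - a * b) + a * b * c * (2 - d)) :=
    mul_nonneg (mul_nonneg d0 (sub_nonneg.2 d1)) (by linarith)
  linarith [key, hsum]

/-- **Kahn's Conjecture 5 is inherited under a common independent AND-factor**: if `E₃(A,B,C) ≥ 0` for increasing `A, B, C`
determined by `F`, then `E₃(A∩D, B∩D, C∩D) ≥ 0` for every `D` determined by `Fᶜ`. [this work] -/
theorem sahiE3_inter_commonFactor_nonneg (p : ι → unitInterval) (F : Finset ι) {A B C D : Set (Set ι)}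
    (hA : IsUpperSet A) (hB : IsUpperSet B) (hC : IsUpperSet C)
    (dA : DeterminedBy A (↑F : Set ι)) (dB : DeterminedBy B (↑F : Set ι)) (dC : DeterminedBy C (↑F : Set ι))
    (dD : DeterminedBy D (↑F : Set ι)ᶜ) (h : 0 ≤ sahiE3 (prodBernoulli p) A B C) :
    0 ≤ sahiE3 (prodBernoulli p) (A ∩ D) (B ∩ D) (C ∩ D) :=
  le_trans (mul_nonneg measureReal_nonneg h) (sahiE3_inter_commonFactor_ge p F hA hB hC dA dB dC dD)

end SahiCommonFactor

end Summit.CriticalPhenomena.PercolationContinuityZ3.Theorems
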